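import Literature.NumberTheory.GaussSums.EisensteinCubicGaussSums
import Literature.NumberTheory.GaussSums.KummerClassesEquidistributionHeckeProofs
import HarnessLib

/-!
# Kummer's three classes: Heath-Brown–Patterson's Theorem 1 (+ Patterson's identity) ⇒ density `1/3` each

Topic `NumberTheory/GaussSums`; namespace `Literature.NumberTheory.GaussSums`, grouping sub-namespace
`HeathBrownPatterson`. Proofs only (definitions with bodies + theorems); NO named fact.

Source (READ, GDZ scan, EuDML 152154): D. R. Heath-Brown, S. J. Patterson, *The distribution of Kummer
sums at prime arguments*, J. reine angew. Math. 310 (1979) 111–130 [cite: HeathBrownPatterson1979].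
The fact `HeathBrownPatterson1979_kummerClasses` (file `KummerClassesEquidistribution`) is the corollary
(Ireland–Rosen p. 138; the paper's Theorem 2, p. 113, deduced on p. 115 from Theorem 1, p. 112) that each
of Kummer's three classes of primes `p ≡ 1 (mod 3)` has natural density `1/3`. The sibling files
`KummerClassesEquidistributionProofs` / `…HeckeProofs` reduce it (sorry-free) to the paper's display
(p. 115) `Σ_{p ≤ X, p ≡ 1 (3)} cos(k θ_p) = o(π(X; 3, 1))` for every `k` with `3 ∤ k`
(`HeathBrownPatterson1979_kummerClasses_of_heathBrownPatterson`; the case `3 ∣ k` is Hecke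
equidistribution of the cubic Grössencharacter, proved there).

This file carries out, verbatim, the paper's own derivation (§2, p. 115) of those Weyl sums from

* **Theorem 1** (p. 112; prime form p. 115, hypothesis `hT1` below, stated with the objects of
  `EisensteinCubicGaussSums`): for every `ε > 0`,
  `Σ_{N(π) ≤ X, π ≡ 1 (3) prime} g̃(π) (π̄/|π|)^l ≪_ε X^ε (X^{30/31} + |l| X^{29/31})`
  uniformly in `l ∈ ℤ` — this rests on the Kubota–Patterson cubic theta function (Lemma 4, p. 126)
  and is NOT vendored by this (proving) seat; and
* **Patterson's identity** (p. 111, "one can show that", citing Patterson [16] App. II; hypothesis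
  `hP`): for a primary prime `ϖ` of prime norm `p`, `g(ϖ) = Σ_{j=1}^{p-1} (j/ϖ)₃ e^{2πij/p}`, i.e. the
  cubic Gauss sum over `ℤ[ω]/(ϖ)` equals the rational one over `ℤ/p` (equivalently `(Tr/ϖ)`-twist is
  trivial; a consequence of cubic reciprocity and its supplement).

**Architecture (p. 115 of the paper, mirrored lemma by lemma).**

1. (`§ SplitPrime`) For `ϖ` primary of prime norm `p`: `ℤ[ω]/(ϖ) ≅ ℤ/p` (`residueIso`), the cubic
   character `η = (·/ϖ)₃` on `ℤ/p` (`eta`, of order `3`), and under `hP`, `g(ϖ) = gaussSum η e_p`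
   (`gauss_eq_gaussSum_eta`); hence (Mathlib's `gaussSum_pow_eq_prod_jacobiSum` is not needed: we use
   the tree's `cubicGaussSum_pow_three`/Jacobi-sum evaluation through `η = χ_r^{±1}`,
   `eta_eq_or_eq_inv`) `g(ϖ) ∈ {G_p(r), conj G_p(r)}` where `G_p(r) = cubicGaussSum p r` is the tree's
   Kummer/Gauss sum (`gauss_eq_or_eq_conj`), and `g(ϖ)³ = −p ϖ` (`gauss_pow_three`, the paper's
   `g(c)³ = μ(c)c²c̄` at a prime, in the embedding with `ϖ ↦ conj`-normalised sign as printed p. 115: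
   `g̃(π)³ = −π̄/|π|`-type identity `gaussTilde_pow_three`).
2. (`§ SplitPrime2`) p. 115, lines 5–9: writing `k = 3m ± 1`,
   `g̃(π)^{3m+1} = (−1)^m g̃(π) (π̄/|π|)^{−m}`-type identities (`pow_three_mul_add_one/_two`), so that
   `2 cos(k θ_p) = g̃(π)^k + g̃(π̄)^k` is `± (F_l(π) + F_l(π̄))` or its conjugate with
   `F_l(π) = g̃(π)(π̄/|π|)^l`, `|l| ≤ k` (`Gk_add_Gk_conjPrime`, `Gk_eq_of_mod_three`).
3. (`§ Fibre`, `§ Assembly`) summing over `p ≤ N`, the pairs `{π, π̄}` exhaust the primary primes of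
   norm `≤ N` up to the inert ones, which contribute `≤ √N + 2`
   (`KummerClasses.sum_biUnion_eq_split_add_nonsplit`, `norm_sum_nonsplit_le` from the Hecke file);
   so `|Σ_{p ≤ N} cos(k θ_p)| ≤ ½ (‖Σ_{N(π) ≤ N} F_l(π)‖ + √N + 2)` (`abs_sum_cos_le`).
4. (`§ Asymptotics`) Theorem 1 with `ε = 1/62` gives `O_k(N^{61/62})`, which is `o(π(N; 3, 1))` since
   `π(N; 3, 1) ~ N/(2 log N)` (`tendsto_kummerPrimeCount_succ_mul_log_div`, Hecke file).
5. `HeathBrownPatterson1979_kummerClasses_of_thm1_of_patterson : hT1 → hP → kummerClasses`.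

What remains between this theorem and an unconditional `HeathBrownPatterson1979_kummerClasses_holds`
is exactly: a vendored Theorem 1 (XL: cubic metaplectic theta function) and Patterson's identity
(M: cubic reciprocity incl. the supplement for `1 − ω`; the tree has Eisenstein reciprocity
`Literature.NumberTheory.Reciprocity` but not yet the supplement in the needed form).

## References
* [HeathBrownPatterson1979] D. R. Heath-Brown, S. J. Patterson, J. reine angew. Math. 310 (1979)
  111–130, Thm 1 p. 112, Thm 2 p. 113, §2 p. 115. doi:10.1515/crll.1979.310.111.
* [Patterson1978KummerSums] S. J. Patterson, *On the distribution of Kummer sums*, J. reine angew.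
  Math. 303/304 (1978) 126–143, App. II.
* [IrelandRosen1990] K. Ireland, M. Rosen, *A Classical Introduction to Modern Number Theory*, GTM 84,
  Ch. 9 §§3–4 and p. 138.
-/

noncomputable section

open NumberField IsDedekindDomain Complex Finset Filter Asymptotics
open scoped ComplexConjugate

namespace Literature.NumberTheory.GaussSums

open Literature.NumberTheory.NumberFields Literature.NumberTheory.NumberFields.K3
open Literature.NumberTheory.GaloisRepresentations
open Literature.NumberTheory.LFunctions Literature.NumberTheory.LFunctions.EisensteinGrossen

namespace HeathBrownPatterson

/-! ### Transport of a multiplicative character along a ring isomorphism -/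

section Comap

variable {R R' : Type*} [CommRing R] [CommRing R']

/-- Pull back a complex multiplicative character along a ring isomorphism. [folklore] -/
def mulCharComap (χ : MulChar R' ℂ) (φ : R ≃+* R') : MulChar R ℂ where
  toFun x := χ (φ x)
  map_one' := by simp
  map_mul' x y := by simp [map_mul]
  map_nonunit' a ha := χ.map_nonunit fun h ↦ ha (by simpa using h.map φ.symm)

/-- Unfolding. [folklore] -/
@[simp] theorem mulCharComap_apply (χ : MulChar R' ℂ) (φ : R ≃+* R') (x : R) :
    mulCharComap χ φ x = χ (φ x) := rfl

end Comap

/-! ### A primary prime `ϖ` of prime norm `p`: the residue field `ℤ[ω]/(ϖ) ≅ ℤ/p` -/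

section SplitPrime

variable {ϖ : 𝓞 K3} {p : ℕ}

/-- The `Fintype` structure on the residue ring of a prime. [folklore] -/
@[reducible] def fintypeQuot (hϖ : Prime ϖ) : Fintype (𝓞 K3 ⧸ Ideal.span ({ϖ} : Set (𝓞 K3))) :=
  haveI : NeZero ϖ := ⟨hϖ.ne_zero⟩
  Fintype.ofFinite _

/-- `#(ℤ[ω]/(ϖ)) = p`. [folklore] -/
theorem card_quot_eq (hϖ : Prime ϖ) (hN : Ideal.absNorm (Ideal.span ({ϖ} : Set (𝓞 K3))) = p) :
    @Fintype.card (𝓞 K3 ⧸ Ideal.span ({ϖ} : Set (𝓞 K3))) (fintypeQuot hϖ) = p := by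
  rw [@card_quotient_eq ϖ (fintypeQuot hϖ), hN]

/-- **The residue-field isomorphism `ℤ/p ≅ ℤ[ω]/(ϖ)`** for a prime `ϖ` of prime norm `p`.
[cite: HeathBrownPatterson1979, p.111] -/
def residueIso (hϖ : Prime ϖ) [hp : Fact p.Prime] (hN : Ideal.absNorm (Ideal.span ({ϖ} : Set (𝓞 K3))) = p) :
    ZMod p ≃+* 𝓞 K3 ⧸ Ideal.span ({ϖ} : Set (𝓞 K3)) :=
  @ZMod.ringEquivOfPrime _ _ (fintypeQuot hϖ) p hp.out (card_quot_eq hϖ hN)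

/-- `residueIso j = j mod ϖ` for `j ∈ ℕ`. [folklore] -/
theorem residueIso_natCast (hϖ : Prime ϖ) [hp : Fact p.Prime]
    (hN : Ideal.absNorm (Ideal.span ({ϖ} : Set (𝓞 K3))) = p) (j : ℕ) :
    residueIso hϖ hN (j : ZMod p) = Ideal.Quotient.mk (Ideal.span ({ϖ} : Set (𝓞 K3))) (j : 𝓞 K3) := by
  rw [map_natCast, map_natCast]

/-- **The cubic residue symbol of `ϖ` on `ℤ/p`**: `η(j) = (j/ϖ)₃`. [cite: HeathBrownPatterson1979, p.111] -/
def eta (hϖ : Prime ϖ) (hϖ1 : ϖ - 1 ∈ three) [hp : Fact p.Prime]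
    (hN : Ideal.absNorm (Ideal.span ({ϖ} : Set (𝓞 K3))) = p) : MulChar (ZMod p) ℂ :=
  mulCharComap (chi hϖ (three_not_mem_span_of_sub_one_mem hϖ hϖ1)) (residueIso hϖ hN)

/-- `η(j) = cubicSymbol ϖ j` for `j ∈ ℕ`. [folklore] -/
theorem eta_natCast (hϖ : Prime ϖ) (hϖ1 : ϖ - 1 ∈ three) [hp : Fact p.Prime]
    (hN : Ideal.absNorm (Ideal.span ({ϖ} : Set (𝓞 K3))) = p) (j : ℕ) : eta hϖ hϖ1 hN (j : ZMod p) = cubicSymbol ϖ (j : 𝓞 K3) := by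
  unfold eta
  rw [mulCharComap_apply, residueIso_natCast, chi_mk]

/-- `η³ = 1`. [folklore] -/
theorem eta_pow_three (hϖ : Prime ϖ) (hϖ1 : ϖ - 1 ∈ three) [hp : Fact p.Prime]
    (hN : Ideal.absNorm (Ideal.span ({ϖ} : Set (𝓞 K3))) = p) : eta hϖ hϖ1 hN ^ 3 = 1 := by
  refine MulChar.ext fun u ↦ ?_
  rw [MulChar.pow_apply_coe, MulChar.one_apply_coe]
  unfold eta
  rw [mulCharComap_apply]
  rcases chi_eq_zero_or_pow_three hϖ (three_not_mem_span_of_sub_one_mem hϖ hϖ1)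
    (residueIso hϖ hN u) with h | h
  · exfalso
    have hu : IsUnit (residueIso hϖ hN (u : ZMod p)) := (Units.isUnit u).map _
    exact (hu.map (chi hϖ (three_not_mem_span_of_sub_one_mem hϖ hϖ1))).ne_zero h
  · exact h

/-- `η ≠ 1`. [folklore] -/
theorem eta_ne_one (hϖ : Prime ϖ) (hϖ1 : ϖ - 1 ∈ three) [hp : Fact p.Prime]
    (hN : Ideal.absNorm (Ideal.span ({ϖ} : Set (𝓞 K3))) = p) : eta hϖ hϖ1 hN ≠ 1 := by
  intro h1
  apply chi_ne_one hϖ (three_not_mem_span_of_sub_one_mem hϖ hϖ1)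
  refine MulChar.ext fun u ↦ ?_
  have key := congrArg (fun χ : MulChar (ZMod p) ℂ ↦ χ ((residueIso hϖ hN).symm u)) h1
  simp only [eta, mulCharComap_apply, RingEquiv.apply_symm_apply] at key
  rw [key, MulChar.one_apply_coe, MulChar.one_apply]
  exact (Units.isUnit u).map _

/-- `η` has order `3`. [folklore] -/
theorem orderOf_eta (hϖ : Prime ϖ) (hϖ1 : ϖ - 1 ∈ three) [hp : Fact p.Prime]
    (hN : Ideal.absNorm (Ideal.span ({ϖ} : Set (𝓞 K3))) = p) : orderOf (eta hϖ hϖ1 hN) = 3 :=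
  orderOf_eq_prime (eta_pow_three hϖ hϖ1 hN) (eta_ne_one hϖ hϖ1 hN)

/-- `η(−1) = 1`. [folklore] -/
theorem eta_neg_one (hϖ : Prime ϖ) (hϖ1 : ϖ - 1 ∈ three) [hp : Fact p.Prime]
    (hN : Ideal.absNorm (Ideal.span ({ϖ} : Set (𝓞 K3))) = p) : eta hϖ hϖ1 hN (-1) = 1 := by
  unfold eta
  rw [mulCharComap_apply, map_neg, map_one]
  exact chi_neg_one hϖ (three_not_mem_span_of_sub_one_mem hϖ hϖ1)

/-- `(0/ϖ)₃ = 0`. [folklore] -/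
theorem cubicSymbol_zero_right (hϖ : Prime ϖ) (hϖ1 : ϖ - 1 ∈ three) [hp : Fact p.Prime]
    (hN : Ideal.absNorm (Ideal.span ({ϖ} : Set (𝓞 K3))) = p) : cubicSymbol ϖ 0 = 0 := by
  have h := eta_natCast hϖ hϖ1 hN 0
  rw [Nat.cast_zero, Nat.cast_zero, MulChar.map_zero] at h
  exact h.symm

/-- **Patterson's identity in Gauss-sum form**: if `g(ϖ) = Σ_{j=1}^{p−1} (j/ϖ)₃ e^{2πij/p}` then
`g(ϖ)` is Mathlib's Gauss sum of `η` and the standard additive character of `ℤ/p`.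
[cite: HeathBrownPatterson1979, p.111; Patterson1978KummerSums, Appendix II] -/
theorem gauss_eq_gaussSum_eta (hϖ : Prime ϖ) (hϖ1 : ϖ - 1 ∈ three) [hp : Fact p.Prime]
    (hN : Ideal.absNorm (Ideal.span ({ϖ} : Set (𝓞 K3))) = p)
    (hPϖ : gauss ϖ = ∑ j ∈ Finset.Ico 1 p, cubicSymbol ϖ (j : 𝓞 K3) *
      Complex.exp (2 * Real.pi * Complex.I * j / p)) :
    gauss ϖ = gaussSum (eta hϖ hϖ1 hN) (ZMod.stdAddChar (N := p)) := by
  rw [hPϖ]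
  -- add the vanishing `j = 0` term and pass to `ZMod p`
  have hp1 := hp.out.pos
  have h0 : ∑ j ∈ Finset.Ico 1 p, cubicSymbol ϖ (j : 𝓞 K3) * Complex.exp (2 * Real.pi * Complex.I * j / p) =
      ∑ j ∈ Finset.range p, cubicSymbol ϖ (j : 𝓞 K3) * Complex.exp (2 * Real.pi * Complex.I * j / p) := by
    rw [Finset.range_eq_Ico]
    have h01 : Finset.Ico 0 p = insert 0 (Finset.Ico 1 p) := by
      ext j
      simp only [Finset.mem_Ico, Finset.mem_insert]
      omega
    rw [h01, Finset.sum_insert (by simp), Nat.cast_zero, Nat.cast_zero,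
      cubicSymbol_zero_right hϖ hϖ1 hN, zero_mul, zero_add]
  rw [h0]
  unfold gaussSum
  refine Finset.sum_nbij' (fun a : ℕ ↦ (a : ZMod p)) ZMod.val (fun _ _ ↦ Finset.mem_univ _)
    (fun a _ ↦ Finset.mem_range.mpr (ZMod.val_lt a))
    (fun a ha ↦ ZMod.val_natCast_of_lt (Finset.mem_range.mp ha))
    (fun a _ ↦ ZMod.natCast_zmod_val a) (fun a _ ↦ ?_)
  rw [eta_natCast, ZMod.stdAddChar_apply, ZMod.toCircle_natCast]

/-- **Transport of the Jacobi sum**: `J(η, η) = embC (J(χ_ϖ, χ_ϖ))`. [folklore] -/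
theorem jacobiSum_eta (hϖ : Prime ϖ) (hϖ1 : ϖ - 1 ∈ three) [hp : Fact p.Prime]
    (hN : Ideal.absNorm (Ideal.span ({ϖ} : Set (𝓞 K3))) = p) :
    jacobiSum (eta hϖ hϖ1 hN) (eta hϖ hϖ1 hN) =
      embC ((cubicJacobiSum hζ (primeOf hϖ) (three_not_mem_span_of_sub_one_mem hϖ hϖ1) : 𝓞 K3) : K3) := by
  letI : Fintype (𝓞 K3 ⧸ Ideal.span ({ϖ} : Set (𝓞 K3))) := fintypeQuot hϖ
  letI : Fintype (𝓞 K3 ⧸ (primeOf hϖ).asIdeal) := fintypeQuot hϖ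
  have hJ := @cubicJacobiSum_eq K3 _ _ _ hζ (primeOf hϖ) (three_not_mem_span_of_sub_one_mem hϖ hϖ1)
    (fintypeQuot hϖ)
  rw [hJ]
  unfold jacobiSum
  have hcoe : (((∑ x, (cubicResidueChar hζ (primeOf hϖ) (three_not_mem_span_of_sub_one_mem hϖ hϖ1) x *
      cubicResidueChar hζ (primeOf hϖ) (three_not_mem_span_of_sub_one_mem hϖ hϖ1) (1 - x)) : 𝓞 K3) : K3)) =
      ∑ x, (((cubicResidueChar hζ (primeOf hϖ) (three_not_mem_span_of_sub_one_mem hϖ hϖ1) x *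
        cubicResidueChar hζ (primeOf hϖ) (three_not_mem_span_of_sub_one_mem hϖ hϖ1) (1 - x) : 𝓞 K3)) : K3) :=
    map_sum (algebraMap (𝓞 K3) K3) _ _
  rw [hcoe, map_sum embC]
  refine Fintype.sum_equiv (residueIso hϖ hN).toEquiv _ _ (fun x ↦ ?_)
  simp only [eta, mulCharComap_apply, RingEquiv.toEquiv_eq_coe, EquivLike.coe_coe, map_sub, map_one,
    map_mul, cubicResidueChar_apply]
  rw [chi_apply, chi_apply]
  rfl

/-- **The cube of the Gauss sum**: `g(ϖ)³ = −p·ϖ` (in `ℂ`), i.e. `g̃(ϖ)³ = −ϖ/|ϖ|`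
(Heath-Brown–Patterson p. 112), for a primary prime `ϖ` of prime norm `p` satisfying Patterson's
identity; from `g³ = η(−1) p J(η,η)` (Mathlib) and `J(χ_ϖ, χ_ϖ) = −ϖ` (tree, Ireland–Rosen 9.4 Lemma 1).
[cite: HeathBrownPatterson1979, p.112 "g̃(π)³ = −π/|π|"] -/
theorem gauss_pow_three (hϖ : Prime ϖ) (hϖ1 : ϖ - 1 ∈ three) [hp : Fact p.Prime]
    (hN : Ideal.absNorm (Ideal.span ({ϖ} : Set (𝓞 K3))) = p)
    (hPϖ : gauss ϖ = ∑ j ∈ Finset.Ico 1 p, cubicSymbol ϖ (j : 𝓞 K3) *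
      Complex.exp (2 * Real.pi * Complex.I * j / p)) :
    gauss ϖ ^ 3 = -(p : ℂ) * embC ((ϖ : 𝓞 K3) : K3) := by
  have hord := orderOf_eta hϖ hϖ1 hN
  have h := gaussSum_pow_eq_prod_jacobiSum (χ := eta hϖ hϖ1 hN) (ψ := ZMod.stdAddChar)
    (by rw [hord]; norm_num) (ZMod.isPrimitive_stdAddChar p)
  rw [hord] at h
  rw [gauss_eq_gaussSum_eta hϖ hϖ1 hN hPϖ, h, eta_neg_one, ZMod.card, one_mul,
    show Finset.Ico 1 (3 - 1) = {1} by rfl, Finset.prod_singleton, pow_one, jacobiSum_eta,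
    cubicJacobiSum_eq_neg_of_span_eq hζ (primeOf hϖ) _ (primeOf_asIdeal hϖ) hϖ1]
  simp

/-- `‖embC ϖ‖ = √p`. [folklore] -/
theorem norm_embC_eq_sqrt (hN : Ideal.absNorm (Ideal.span ({ϖ} : Set (𝓞 K3))) = p) :
    ‖embC ((ϖ : 𝓞 K3) : K3)‖ = Real.sqrt p := by
  rw [← Real.sqrt_sq (norm_nonneg _), ← absNorm_span_singleton_eq, hN]

/-- **`g̃(ϖ)³ = −ϖ/|ϖ|`.** [cite: HeathBrownPatterson1979, p.112] -/
theorem gaussTilde_pow_three (hϖ : Prime ϖ) (hϖ1 : ϖ - 1 ∈ three) [hp : Fact p.Prime]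
    (hN : Ideal.absNorm (Ideal.span ({ϖ} : Set (𝓞 K3))) = p)
    (hPϖ : gauss ϖ = ∑ j ∈ Finset.Ico 1 p, cubicSymbol ϖ (j : 𝓞 K3) *
      Complex.exp (2 * Real.pi * Complex.I * j / p)) :
    gaussTilde ϖ ^ 3 = -(embC ((ϖ : 𝓞 K3) : K3) / (‖embC ((ϖ : 𝓞 K3) : K3)‖ : ℂ)) := by
  have hp0 : (p : ℂ) ≠ 0 := by exact_mod_cast hp.out.ne_zero
  have hsqpos : 0 < Real.sqrt p := Real.sqrt_pos.mpr (by exact_mod_cast hp.out.pos)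
  unfold gaussTilde
  rw [hN, div_pow, gauss_pow_three hϖ hϖ1 hN hPϖ, norm_embC_eq_sqrt hN]
  have h2 : ((Real.sqrt p : ℝ) : ℂ) ^ 2 = (p : ℂ) := by
    rw [← Complex.ofReal_pow, Real.sq_sqrt (by positivity)]; simp
  have h3 : ((Real.sqrt p : ℝ) : ℂ) ^ 3 = (p : ℂ) * Real.sqrt p := by
    rw [pow_succ, h2]
  rw [h3, neg_mul, neg_div, mul_div_mul_left _ _ hp0]

end SplitPrime

end HeathBrownPatterson

namespace HeathBrownPatterson

section SplitPrime2

variable {ϖ : 𝓞 K3} {p : ℕ}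

/-- **`η` is `χ_{p,r}` or its inverse**: a non-trivial cubic character of `ℤ/p` is determined up to
inversion by the primitive root. [cite: IrelandRosen1990, Prop. 8.1.4] -/
theorem eta_eq_or_eq_inv (hϖ : Prime ϖ) (hϖ1 : ϖ - 1 ∈ three) [hp : Fact p.Prime]
    (hN : Ideal.absNorm (Ideal.span ({ϖ} : Set (𝓞 K3))) = p) (h3 : p % 3 = 1) {r : ℕ} (hr : IsPrimitiveRoot (r : ZMod p) (p - 1)) :
    eta hϖ hϖ1 hN = cubicMulChar h3 hr ∨ eta hϖ hϖ1 hN = (cubicMulChar h3 hr)⁻¹ := by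
  have hg := forall_mem_zpowers_of_isPrimitiveRoot hr
  set e := eta hϖ hϖ1 hN (r : ZMod p) with he
  have he3 : e ^ 3 = 1 := by
    have h := congrArg (fun χ : MulChar (ZMod p) ℂ ↦
      χ ((hr.isUnit (Nat.sub_ne_zero_of_lt hp.out.one_lt)).unit : ZMod p)) (eta_pow_three hϖ hϖ1 hN)
    rw [MulChar.pow_apply_coe, MulChar.one_apply_coe, IsUnit.unit_spec] at h
    exact h
  have he1 : e ≠ 1 := by
    intro h1
    apply eta_ne_one hϖ hϖ1 hN
    rw [MulChar.eq_iff hg, MulChar.one_apply_coe, IsUnit.unit_spec]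
    exact h1
  obtain ⟨i, hi, hie⟩ := omega_isPrimitiveRoot.eq_pow_of_pow_eq_one he3
  interval_cases i
  · rw [pow_zero] at hie; exact absurd hie.symm he1
  · left
    rw [MulChar.eq_iff hg, IsUnit.unit_spec, cubicMulChar_apply_self, ← he, ← hie, pow_one]
  · right
    rw [MulChar.eq_iff hg, MulChar.inv_apply_eq_inv', IsUnit.unit_spec, cubicMulChar_apply_self,
      omega_inv, ← he, ← hie]

/-- **`g(ϖ)` is the classical cubic Gauss sum of `p` or its conjugate** (given Patterson's
identity). [cite: HeathBrownPatterson1979, p.111] -/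
theorem gauss_eq_or_eq_conj (hϖ : Prime ϖ) (hϖ1 : ϖ - 1 ∈ three) [hp : Fact p.Prime]
    (hN : Ideal.absNorm (Ideal.span ({ϖ} : Set (𝓞 K3))) = p) (h3 : p % 3 = 1) {r : ℕ} (hr : IsPrimitiveRoot (r : ZMod p) (p - 1))
    (hPϖ : gauss ϖ = ∑ j ∈ Finset.Ico 1 p, cubicSymbol ϖ (j : 𝓞 K3) *
      Complex.exp (2 * Real.pi * Complex.I * j / p)) :
    gauss ϖ = cubicGaussSum p r ∨ gauss ϖ = conj (cubicGaussSum p r) := by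
  rw [gauss_eq_gaussSum_eta hϖ hϖ1 hN hPϖ]
  rcases eta_eq_or_eq_inv hϖ hϖ1 hN h3 hr with h | h
  · left; rw [h, cubicGaussSum_eq_gaussSum h3 hr]
  · right; rw [h, KummerClasses.gaussSum_inv_cubicMulChar h3 hr, cubicGaussSum_eq_gaussSum h3 hr]

end SplitPrime2

/-! ### Powers `g̃(ϖ)^k` for `3 ∤ k` in terms of the Theorem-1 summands -/

/-- `u^{3m+1} = (−1)^m · u · (s̄)^{−m}` for `|u| = |s| = 1`, `u³ = −s`. [cite: HeathBrownPatterson1979, §2 p.115] -/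
theorem pow_three_mul_add_one {u s : ℂ} (hs : ‖s‖ = 1) (h3 : u ^ 3 = -s) (m : ℕ) :
    u ^ (3 * m + 1) = (-1) ^ m * (u * (conj s) ^ (-(m : ℤ))) := by
  have hs' : conj s = s⁻¹ := (Complex.inv_eq_conj hs).symm
  rw [hs', zpow_neg, zpow_natCast, inv_pow, inv_inv, pow_add, pow_one, pow_mul, h3, neg_pow]
  ring

/-- `u^{3m+2} = (−1)^{m+1} · conj (u · (s̄)^{m+1})` for `|u| = |s| = 1`, `u³ = −s`.
[cite: HeathBrownPatterson1979, §2 p.115] -/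
theorem pow_three_mul_add_two {u s : ℂ} (hu : ‖u‖ = 1) (h3 : u ^ 3 = -s) (m : ℕ) :
    u ^ (3 * m + 2) = (-1) ^ (m + 1) * conj (u * (conj s) ^ (((m + 1 : ℕ)) : ℤ)) := by
  have hu0 : u ≠ 0 := by
    intro h; rw [h, norm_zero] at hu; exact zero_ne_one hu
  have hu' : conj u = u⁻¹ := (Complex.inv_eq_conj hu).symm
  rw [zpow_natCast, map_mul, map_pow, Complex.conj_conj, hu']
  have key : u ^ (3 * m + 2) * u = ((-1) ^ (m + 1) * (u⁻¹ * s ^ (m + 1))) * u := by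
    rw [← pow_succ, show 3 * m + 2 + 1 = 3 * (m + 1) by ring, pow_mul, h3, neg_pow]
    field_simp
  exact mul_right_cancel₀ hu0 key

/-! ### The summands as functions of the prime ideals of `ℤ[ω]` -/

/-- The summand of Theorem 1: `g̃(π) (π̄/|π|)^l`. [cite: HeathBrownPatterson1979, Thm 1] -/
def T1term (l : ℤ) (π : 𝓞 K3) : ℂ :=
  gaussTilde π * (conj (embC ((π : 𝓞 K3) : K3)) / (‖embC ((π : 𝓞 K3) : K3)‖ : ℂ)) ^ l

open Classical in
/-- `F_l(𝔭) = g̃(ϖ_𝔭) (ϖ̄_𝔭/|ϖ_𝔭|)^l` at a prime `𝔭 ∤ 3` (`ϖ_𝔭` its primary generator), `0` at `(1 − ω)`. [folklore] -/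
def Fl (l : ℤ) (v : HeightOneSpectrum (𝓞 K3)) : ℂ :=
  if IsCoprime v.asIdeal three then T1term l (primGen v.asIdeal) else 0

open Classical in
/-- `G_k(𝔭) = g̃(ϖ_𝔭)^k` at a prime `𝔭 ∤ 3`, `0` at `(1 − ω)`. [folklore] -/
def Gk (k : ℕ) (v : HeightOneSpectrum (𝓞 K3)) : ℂ :=
  if IsCoprime v.asIdeal three then gaussTilde (primGen v.asIdeal) ^ k else 0

/-- The primary generator of a prime `𝔭 ∤ 3` is a prime element. [folklore] -/
theorem prime_primGen {v : HeightOneSpectrum (𝓞 K3)} (hv : IsCoprime v.asIdeal three) :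
    Prime (primGen v.asIdeal) := by
  have hne := primGen_ne_zero hv v.ne_bot
  rw [← Ideal.span_singleton_prime hne, span_primGen hv]
  exact v.isPrime

/-- `‖(z̄/|z|)^l‖ = 1` for `z ≠ 0`. [folklore] -/
theorem norm_conj_div_norm_zpow {z : ℂ} (hz : z ≠ 0) (l : ℤ) : ‖(conj z / (‖z‖ : ℂ)) ^ l‖ = 1 := by
  rw [norm_zpow, norm_div, Complex.norm_conj, Complex.norm_real, Real.norm_of_nonneg (norm_nonneg _),
    div_self (norm_ne_zero_iff.mpr hz), one_zpow]

/-- `‖T1term l π‖ ≤ 1` for a primary prime `π`. [folklore] -/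
theorem norm_T1term_le {π : 𝓞 K3} (hπ : Prime π) (hπ1 : π - 1 ∈ three) (l : ℤ) : ‖T1term l π‖ ≤ 1 := by
  unfold T1term
  rw [norm_mul, norm_conj_div_norm_zpow (embC_ne_zero hπ.ne_zero), mul_one]
  exact norm_gaussTilde_le_one hπ hπ1

/-- `‖F_l(𝔭)‖ ≤ 1`. [folklore] -/
theorem norm_Fl_le (l : ℤ) (v : HeightOneSpectrum (𝓞 K3)) : ‖Fl l v‖ ≤ 1 := by
  unfold Fl
  split_ifs with hv
  · exact norm_T1term_le (prime_primGen hv) (primGen_sub_one_mem hv) l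
  · rw [norm_zero]; exact zero_le_one

/-- `‖G_k(𝔭)‖ ≤ 1`. [folklore] -/
theorem norm_Gk_le (k : ℕ) (v : HeightOneSpectrum (𝓞 K3)) : ‖Gk k v‖ ≤ 1 := by
  unfold Gk
  split_ifs with hv
  · rw [norm_pow]
    exact pow_le_one₀ (norm_nonneg _) (norm_gaussTilde_le_one (prime_primGen hv) (primGen_sub_one_mem hv))
  · rw [norm_zero]; exact zero_le_one

open Classical KummerClasses in
/-- **Re-indexing**: `Σ_{N𝔭 ≤ N} F_l(𝔭) = Σ_{π prime ≡ 1 (3), N(π) ≤ N} g̃(π) (π̄/|π|)^l` — the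
prime ideals `𝔭 ∤ 3` of norm `≤ N` correspond to their primary generators.
[cite: IrelandRosen1990, Ch. 9 §3 Prop. 9.3.5] -/
theorem sum_Fl_eq (l : ℤ) (N : ℕ) :
    ∑ v ∈ (Icc 1 N).biUnion (primesOfNorm K3), Fl l v = ∑ π ∈ primaryPrimesUpTo N, T1term l π := by
  classical
  unfold Fl
  rw [← Finset.sum_filter]
  refine Finset.sum_nbij' (fun v ↦ primGen v.asIdeal)
    (fun π ↦ if h : Prime π then primeOf h else primeOf prime_lamInt) ?_ ?_ ?_ ?_ ?_
  · intro v hv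
    rw [Finset.mem_filter, mem_biUnion_primesOfNorm] at hv
    rw [mem_primaryPrimesUpTo, span_primGen hv.2]
    exact ⟨prime_primGen hv.2, primGen_sub_one_mem hv.2, hv.1⟩
  · intro π hπ
    rw [mem_primaryPrimesUpTo] at hπ
    rw [dif_pos hπ.1, Finset.mem_filter, mem_biUnion_primesOfNorm, primeOf_asIdeal]
    exact ⟨hπ.2.2, isCoprime_three_of_sub_one_mem hπ.2.1⟩
  · intro v hv
    rw [Finset.mem_filter] at hv
    rw [dif_pos (prime_primGen hv.2)]
    exact HeightOneSpectrum.ext (by rw [primeOf_asIdeal, span_primGen hv.2])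
  · intro π hπ
    rw [mem_primaryPrimesUpTo] at hπ
    simp only [dif_pos hπ.1, primeOf_asIdeal]
    exact primGen_span_singleton hπ.2.1
  · intro v _
    rfl

/-- `N((τ π)) = N((π))`. [folklore] -/
theorem absNorm_span_tau (π : 𝓞 K3) :
    Ideal.absNorm (Ideal.span ({tau π} : Set (𝓞 K3))) = Ideal.absNorm (Ideal.span ({π} : Set (𝓞 K3))) := by
  rw [← map_tau_span, Ideal.absNorm_apply, Ideal.absNorm_apply, Submodule.cardQuot_apply,
    Submodule.cardQuot_apply]
  exact Nat.card_congr (Ideal.quotientEquiv (Ideal.span {π}) _ tau rfl).toEquiv.symm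

/-! ### The split fibres -/

section Fibre

variable {p : ℕ} {v : HeightOneSpectrum (𝓞 K3)}

/-- **`G_k(𝔭) + G_k(𝔭̄) = 2 cos(k θ_p)`** for a prime `p ≡ 1 (mod 3)` with primes `𝔭, 𝔭̄` above it,
`θ_p = arg g(χ_{p,r})` — given Patterson's identity for `ϖ_𝔭`.
[cite: HeathBrownPatterson1979, p.111; IrelandRosen1990, Ch. 9 §12 Lemma 1] -/
theorem Gk_add_Gk_conjPrime [hp : Fact p.Prime] (h3 : p % 3 = 1) {r : ℕ}
    (hr : IsPrimitiveRoot (r : ZMod p) (p - 1)) (hcop : IsCoprime v.asIdeal three)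
    (hN : Ideal.absNorm (Ideal.span ({primGen v.asIdeal} : Set (𝓞 K3))) = p)
    (hPϖ : gauss (primGen v.asIdeal) = ∑ j ∈ Finset.Ico 1 p, cubicSymbol (primGen v.asIdeal) (j : 𝓞 K3) *
      Complex.exp (2 * Real.pi * Complex.I * j / p)) (k : ℕ) :
    Gk k v + Gk k (conjPrime v) = 2 * Real.cos (k * Complex.arg (cubicGaussSum p r)) := by
  set ϖ := primGen v.asIdeal with hϖdef
  have hϖ : Prime ϖ := prime_primGen hcop
  have hϖ1 : ϖ - 1 ∈ three := primGen_sub_one_mem hcop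
  have hϖ3 := three_not_mem_span_of_sub_one_mem hϖ hϖ1
  have hcop' : IsCoprime (conjPrime v).asIdeal three := by
    rw [conjPrime_asIdeal]; exact isCoprime_map_tau hcop
  have hgen : primGen (conjPrime v).asIdeal = tau ϖ := by
    rw [conjPrime_asIdeal, primGen_map_tau hcop]
  unfold Gk
  have hG0 := cubicGaussSum_ne_zero h3 hr
  rw [if_pos hcop, if_pos hcop', hgen, gaussTilde_tau hϖ hϖ3, ← map_pow, Complex.add_conj,
    KummerClasses.cos_nat_mul_arg hG0 k]
  push_cast
  congr 1
  -- `g̃(ϖ) = g/√p = G/|G|` or its conjugate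
  have hnorm : ((Real.sqrt (Ideal.absNorm (Ideal.span ({ϖ} : Set (𝓞 K3)))) : ℝ) : ℂ) =
      (‖cubicGaussSum p r‖ : ℂ) := by
    rw [hN, norm_cubicGaussSum h3 hr]
  have hu : gaussTilde ϖ = cubicGaussSum p r / (‖cubicGaussSum p r‖ : ℂ) ∨
      gaussTilde ϖ = conj (cubicGaussSum p r / (‖cubicGaussSum p r‖ : ℂ)) := by
    unfold gaussTilde
    rw [hnorm, map_div₀, Complex.conj_ofReal]
    rcases gauss_eq_or_eq_conj hϖ hϖ1 hN h3 hr hPϖ with h | h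
    · left; rw [h]
    · right; rw [h]
  rcases hu with h | h
  · rw [h]
  · rw [h, ← map_pow, Complex.conj_re]

/-- **On a split prime, `G_k = ± F_l` (or its conjugate)**: for `k = 3m + 1`,
`g̃(ϖ)^k = (−1)^m g̃(ϖ)(ϖ̄/|ϖ|)^{−m}`; for `k = 3m + 2`, `g̃(ϖ)^k = (−1)^{m+1} conj(g̃(ϖ)(ϖ̄/|ϖ|)^{m+1})`.
[cite: HeathBrownPatterson1979, §2 p.115] -/
theorem Gk_eq_of_mod_three [hp : Fact p.Prime] (hcop : IsCoprime v.asIdeal three)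
    (hN : Ideal.absNorm (Ideal.span ({primGen v.asIdeal} : Set (𝓞 K3))) = p)
    (hPϖ : gauss (primGen v.asIdeal) = ∑ j ∈ Finset.Ico 1 p, cubicSymbol (primGen v.asIdeal) (j : 𝓞 K3) *
      Complex.exp (2 * Real.pi * Complex.I * j / p)) (m : ℕ) :
    Gk (3 * m + 1) v = (-1) ^ m * Fl (-(m : ℤ)) v ∧
      Gk (3 * m + 2) v = (-1) ^ (m + 1) * conj (Fl ((m + 1 : ℕ) : ℤ) v) := by
  set ϖ := primGen v.asIdeal with hϖdef
  have hϖ : Prime ϖ := prime_primGen hcop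
  have hϖ1 : ϖ - 1 ∈ three := primGen_sub_one_mem hcop
  have hϖ3 := three_not_mem_span_of_sub_one_mem hϖ hϖ1
  have hu : ‖gaussTilde ϖ‖ = 1 := norm_gaussTilde hϖ hϖ3
  have he0 : embC ((ϖ : 𝓞 K3) : K3) ≠ 0 := embC_ne_zero hϖ.ne_zero
  have hs : ‖embC ((ϖ : 𝓞 K3) : K3) / (‖embC ((ϖ : 𝓞 K3) : K3)‖ : ℂ)‖ = 1 := by
    rw [norm_div, Complex.norm_real, Real.norm_of_nonneg (norm_nonneg _), div_self (norm_ne_zero_iff.mpr he0)]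
  have h3 := gaussTilde_pow_three hϖ hϖ1 hN hPϖ
  have hconj : conj (embC ((ϖ : 𝓞 K3) : K3) / (‖embC ((ϖ : 𝓞 K3) : K3)‖ : ℂ)) =
      conj (embC ((ϖ : 𝓞 K3) : K3)) / (‖embC ((ϖ : 𝓞 K3) : K3)‖ : ℂ) := by
    rw [map_div₀, Complex.conj_ofReal]
  unfold Gk Fl T1term
  simp only [if_pos hcop, ← hϖdef]
  constructor
  · rw [pow_three_mul_add_one hs h3 m, hconj]
  · rw [pow_three_mul_add_two hu h3 m, hconj]

end Fibre

end HeathBrownPatterson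

namespace HeathBrownPatterson

open scoped Classical

/-! ### Assembly over the rational primes `p ≤ N` (Heath-Brown–Patterson p. 115) -/

section Assembly

variable (vP : ℕ → HeightOneSpectrum (𝓞 K3))
  (hvP : ∀ p : ℕ, p.Prime → p % 3 = 1 → vP p ≠ conjPrime (vP p) ∧
    primesOver p = {vP p, conjPrime (vP p)} ∧ (vP p).residueCard = p ∧ IsCoprime (vP p).asIdeal three)
  (hP : ∀ (ϖ : 𝓞 K3) (p : ℕ), Prime ϖ → ϖ - 1 ∈ three → p.Prime →
    Ideal.absNorm (Ideal.span ({ϖ} : Set (𝓞 K3))) = p →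
    gauss ϖ = ∑ j ∈ Finset.Ico 1 p, cubicSymbol ϖ (j : 𝓞 K3) * Complex.exp (2 * Real.pi * Complex.I * j / p))

/-- **Split primes with their primary generators** (a choice-free package of
`EisensteinGrossen.exists_split_data`): above every `p ≡ 1 (mod 3)` there is a degree-one prime `𝔭 ∤ 3`
with `p𝓞 = 𝔭 𝔭̄`, `𝔭 ≠ 𝔭̄`. [cite: IrelandRosen1990, Ch. 9 §1, Prop. 9.1.4] -/
theorem exists_split_prime (p : ℕ) : ∃ v : HeightOneSpectrum (𝓞 K3), p.Prime → p % 3 = 1 →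
    (v ≠ conjPrime v ∧ primesOver p = {v, conjPrime v} ∧ v.residueCard = p ∧ IsCoprime v.asIdeal three) := by
  by_cases hp : p.Prime ∧ p % 3 = 1
  · obtain ⟨v, ϖ, hne, hover, hpv, hN, -⟩ := exists_split_data hp.1 hp.2
    have h3v : (3 : 𝓞 K3) ∉ v.asIdeal := three_not_mem hp.1 (by omega) hpv
    exact ⟨v, fun _ _ ↦ ⟨hne, hover, hN, (adm_of_not_mem 1 v (by rw [mul_one]; exact h3v)).coprime_three⟩⟩
  · exact ⟨primeOf prime_lamInt, fun h1 h2 ↦ absurd ⟨h1, h2⟩ hp⟩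

/-- Norm of the primary generator of a degree-one prime. [folklore] -/
theorem absNorm_span_primGen_eq {p : ℕ} {v : HeightOneSpectrum (𝓞 K3)} (hN : v.residueCard = p)
    (hcop : IsCoprime v.asIdeal three) :
    Ideal.absNorm (Ideal.span ({primGen v.asIdeal} : Set (𝓞 K3))) = p := by
  rw [span_primGen hcop]; exact hN

/-- The same for the conjugate prime. [folklore] -/
theorem absNorm_span_primGen_conjPrime_eq {p : ℕ} {v : HeightOneSpectrum (𝓞 K3)} (hN : v.residueCard = p)
    (hcop : IsCoprime v.asIdeal three) :
    Ideal.absNorm (Ideal.span ({primGen (conjPrime v).asIdeal} : Set (𝓞 K3))) = p := by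
  rw [conjPrime_asIdeal, primGen_map_tau hcop, absNorm_span_tau]
  exact absNorm_span_primGen_eq hN hcop

/-- The conjugate of a prime `𝔭 ∤ 3` is prime to `3`. [folklore] -/
theorem isCoprime_conjPrime_three {v : HeightOneSpectrum (𝓞 K3)} (hcop : IsCoprime v.asIdeal three) :
    IsCoprime (conjPrime v).asIdeal three := by
  rw [conjPrime_asIdeal]; exact isCoprime_map_tau hcop

include hvP hP in
/-- **Step 1**: `Σ_{p ≤ N, p ≡ 1 (3)} 2cos(k θ_p) = Σ_p (G_k(𝔭_p) + G_k(𝔭̄_p))`.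
[cite: HeathBrownPatterson1979, §2 p.115] -/
theorem sum_two_mul_cos_eq (r : ℕ → ℕ) (hr : ∀ p : ℕ, p.Prime → p % 3 = 1 → IsPrimitiveRoot (r p : ZMod p) (p - 1))
    (k N : ℕ) :
    ∑ p ∈ (range (N + 1)).filter (fun p ↦ p.Prime ∧ p % 3 = 1),
        (2 * (Real.cos (k * Complex.arg (cubicGaussSum p (r p))) : ℂ)) =
      ∑ p ∈ (range (N + 1)).filter (fun p ↦ p.Prime ∧ p % 3 = 1), (Gk k (vP p) + Gk k (conjPrime (vP p))) := by
  refine Finset.sum_congr rfl fun p hp ↦ ?_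
  rw [Finset.mem_filter] at hp
  obtain ⟨-, -, hN, hcop⟩ := hvP p hp.2.1 hp.2.2
  haveI : Fact p.Prime := ⟨hp.2.1⟩
  have hNϖ := absNorm_span_primGen_eq hN hcop
  rw [Gk_add_Gk_conjPrime hp.2.2 (hr p hp.2.1 hp.2.2) hcop hNϖ
    (hP _ p (prime_primGen hcop) (primGen_sub_one_mem hcop) hp.2.1 hNϖ) k]

include hvP hP in
/-- **Step 2** (`k = 3m + 1`): `Σ_p (G_k(𝔭_p) + G_k(𝔭̄_p)) = (−1)^m Σ_p (F_{−m}(𝔭_p) + F_{−m}(𝔭̄_p))`.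
[cite: HeathBrownPatterson1979, §2 p.115] -/
theorem sum_Gk_eq_of_mod_one (m N : ℕ) :
    ∑ p ∈ (range (N + 1)).filter (fun p ↦ p.Prime ∧ p % 3 = 1),
        (Gk (3 * m + 1) (vP p) + Gk (3 * m + 1) (conjPrime (vP p))) =
      (-1) ^ m * ∑ p ∈ (range (N + 1)).filter (fun p ↦ p.Prime ∧ p % 3 = 1),
        (Fl (-(m : ℤ)) (vP p) + Fl (-(m : ℤ)) (conjPrime (vP p))) := by
  rw [Finset.mul_sum]
  refine Finset.sum_congr rfl fun p hp ↦ ?_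
  rw [Finset.mem_filter] at hp
  obtain ⟨-, -, hN, hcop⟩ := hvP p hp.2.1 hp.2.2
  haveI : Fact p.Prime := ⟨hp.2.1⟩
  have hNϖ := absNorm_span_primGen_eq hN hcop
  have hNϖ' := absNorm_span_primGen_conjPrime_eq hN hcop
  have hcop' := isCoprime_conjPrime_three hcop
  rw [(Gk_eq_of_mod_three hcop hNϖ (hP _ p (prime_primGen hcop) (primGen_sub_one_mem hcop) hp.2.1 hNϖ) m).1,
    (Gk_eq_of_mod_three hcop' hNϖ' (hP _ p (prime_primGen hcop') (primGen_sub_one_mem hcop') hp.2.1 hNϖ') m).1,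
    mul_add]

include hvP hP in
/-- **Step 2** (`k = 3m + 2`): `Σ_p (G_k(𝔭_p) + G_k(𝔭̄_p)) = (−1)^{m+1} conj Σ_p (F_{m+1}(𝔭_p) + F_{m+1}(𝔭̄_p))`.
[cite: HeathBrownPatterson1979, §2 p.115] -/
theorem sum_Gk_eq_of_mod_two (m N : ℕ) :
    ∑ p ∈ (range (N + 1)).filter (fun p ↦ p.Prime ∧ p % 3 = 1),
        (Gk (3 * m + 2) (vP p) + Gk (3 * m + 2) (conjPrime (vP p))) =
      (-1) ^ (m + 1) * conj (∑ p ∈ (range (N + 1)).filter (fun p ↦ p.Prime ∧ p % 3 = 1),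
        (Fl ((m + 1 : ℕ) : ℤ) (vP p) + Fl ((m + 1 : ℕ) : ℤ) (conjPrime (vP p)))) := by
  rw [map_sum, Finset.mul_sum]
  refine Finset.sum_congr rfl fun p hp ↦ ?_
  rw [Finset.mem_filter] at hp
  obtain ⟨-, -, hN, hcop⟩ := hvP p hp.2.1 hp.2.2
  haveI : Fact p.Prime := ⟨hp.2.1⟩
  have hNϖ := absNorm_span_primGen_eq hN hcop
  have hNϖ' := absNorm_span_primGen_conjPrime_eq hN hcop
  have hcop' := isCoprime_conjPrime_three hcop
  rw [(Gk_eq_of_mod_three hcop hNϖ (hP _ p (prime_primGen hcop) (primGen_sub_one_mem hcop) hp.2.1 hNϖ) m).2,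
    (Gk_eq_of_mod_three hcop' hNϖ' (hP _ p (prime_primGen hcop') (primGen_sub_one_mem hcop') hp.2.1 hNϖ') m).2,
    map_add, mul_add]

include hvP in
open KummerClasses in
/-- **Step 3**: the split pairs make up the whole sum over `N𝔭 ≤ N` except for the inert primes,
which contribute `O(√N)`: `‖Σ_p (F_l(𝔭_p) + F_l(𝔭̄_p))‖ ≤ ‖Σ_{N(π) ≤ N} g̃(π)(π̄/|π|)^l‖ + √N + 2`.
[cite: HeathBrownPatterson1979, §2 p.115] -/
theorem norm_sum_Fl_pair_le (l : ℤ) (N : ℕ) :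
    ‖∑ p ∈ (range (N + 1)).filter (fun p ↦ p.Prime ∧ p % 3 = 1), (Fl l (vP p) + Fl l (conjPrime (vP p)))‖ ≤
      ‖∑ π ∈ primaryPrimesUpTo N, T1term l π‖ + (Nat.sqrt N + 2) := by
  have hvP' : ∀ p : ℕ, p.Prime → p % 3 = 1 → vP p ≠ conjPrime (vP p) ∧
      primesOver p = {vP p, conjPrime (vP p)} ∧ (vP p).residueCard = p :=
    fun p hp h1 ↦ ⟨(hvP p hp h1).1, (hvP p hp h1).2.1, (hvP p hp h1).2.2.1⟩
  have hdec := sum_biUnion_eq_split_add_nonsplit (Fl l) vP hvP' N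
  rw [sum_Fl_eq] at hdec
  rw [eq_sub_of_add_eq hdec.symm]
  refine (norm_sub_le _ _).trans ?_
  gcongr
  exact_mod_cast norm_sum_nonsplit_le (Fl l) (norm_Fl_le l) N

include hvP hP in
/-- **Step 4 — the Weyl sums of the rational primes against the sums of Theorem 1.**
For `3 ∤ k` there is `l ∈ ℤ`, `|l| ≤ k`, with
`|Σ_{p ≤ N, p ≡ 1 (3)} cos(k θ_p)| ≤ ½ (‖Σ_{N(π) ≤ N} g̃(π)(π̄/|π|)^l‖ + √N + 2)` for all `N`.
[cite: HeathBrownPatterson1979, §2 p.115] -/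
theorem abs_sum_cos_le (r : ℕ → ℕ) (hr : ∀ p : ℕ, p.Prime → p % 3 = 1 → IsPrimitiveRoot (r p : ZMod p) (p - 1))
    {k : ℕ} (hk : ¬ 3 ∣ k) :
    ∃ l : ℤ, |l| ≤ k ∧ ∀ N : ℕ,
      |∑ p ∈ (range (N + 1)).filter (fun p ↦ p.Prime ∧ p % 3 = 1), Real.cos (k * Complex.arg (cubicGaussSum p (r p)))| ≤
        (‖∑ π ∈ primaryPrimesUpTo N, T1term l π‖ + (Nat.sqrt N + 2)) / 2 := by
  -- the real sum is half the complex sum of Step 1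
  have hreal : ∀ N : ℕ, ((∑ p ∈ (range (N + 1)).filter (fun p ↦ p.Prime ∧ p % 3 = 1),
      Real.cos (k * Complex.arg (cubicGaussSum p (r p))) : ℝ) : ℂ) =
      (∑ p ∈ (range (N + 1)).filter (fun p ↦ p.Prime ∧ p % 3 = 1), (Gk k (vP p) + Gk k (conjPrime (vP p)))) / 2 := by
    intro N
    rw [← sum_two_mul_cos_eq vP hvP hP r hr k N, Finset.sum_div]
    push_cast
    refine Finset.sum_congr rfl fun p _ ↦ ?_
    ring
  have hk3 : k % 3 = 1 ∨ k % 3 = 2 := by omega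
  rcases hk3 with h1 | h2
  · obtain ⟨m, rfl⟩ : ∃ m, k = 3 * m + 1 := ⟨k / 3, by omega⟩
    refine ⟨-(m : ℤ), ?_, fun N ↦ ?_⟩
    · rw [abs_neg, Nat.abs_cast]; exact_mod_cast (by omega : m ≤ 3 * m + 1)
    have key := hreal N
    rw [sum_Gk_eq_of_mod_one vP hvP hP m N] at key
    have hn := congrArg (fun z : ℂ ↦ ‖z‖) key
    simp only [Complex.norm_real, Real.norm_eq_abs, norm_div, norm_mul, norm_pow, norm_neg, norm_one, one_pow,
      one_mul, Complex.norm_two] at hn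
    rw [hn]
    gcongr
    exact norm_sum_Fl_pair_le vP hvP _ N
  · obtain ⟨m, rfl⟩ : ∃ m, k = 3 * m + 2 := ⟨k / 3, by omega⟩
    refine ⟨((m + 1 : ℕ) : ℤ), ?_, fun N ↦ ?_⟩
    · rw [Nat.abs_cast]; exact_mod_cast (by omega : m + 1 ≤ 3 * m + 2)
    have key := hreal N
    rw [sum_Gk_eq_of_mod_two vP hvP hP m N] at key
    have hn := congrArg (fun z : ℂ ↦ ‖z‖) key
    simp only [Complex.norm_real, Real.norm_eq_abs, norm_div, norm_mul, norm_pow, norm_neg, norm_one, one_pow,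
      one_mul, Complex.norm_conj, Complex.norm_two] at hn
    rw [hn]
    gcongr
    exact norm_sum_Fl_pair_le vP hvP _ N

end Assembly

/-! ### Asymptotics: a power saving is `o(#{p ≤ N : p ≡ 1 (3)})` -/

section Asymptotics

/-- `log N / N^{1/62} → 0` along the naturals. [folklore] -/
theorem tendsto_log_div_rpow :
    Tendsto (fun N : ℕ ↦ Real.log N / (N : ℝ) ^ (1 / 62 : ℝ)) atTop (nhds 0) :=
  ((isLittleO_log_rpow_atTop (by norm_num : (0 : ℝ) < 1 / 62)).tendsto_div_nhds_zero).comp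
    tendsto_natCast_atTop_atTop

/-- **A bound `|a_N| ≤ K N^{61/62}` makes `a_N = o(#{p ≤ N : p ≡ 1 (mod 3)})`**, the latter being
`~ N/(2 log N)` (`tendsto_kummerPrimeCount_succ_mul_log_div`, the prime ideal theorem of `ℚ(ω)`).
[folklore] -/
theorem tendsto_div_kummerPrimeCount_of_le {a : ℕ → ℝ} {K : ℝ}
    (ha : ∀ N : ℕ, 1 ≤ N → |a N| ≤ K * (N : ℝ) ^ (61 / 62 : ℝ)) :
    Tendsto (fun N : ℕ ↦ a N / (kummerPrimeCount (N + 1) : ℝ)) atTop (nhds 0) := by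
  -- numerator `a_N log N / N → 0`
  have hnum : Tendsto (fun N : ℕ ↦ a N * Real.log N / N) atTop (nhds 0) := by
    have hK := tendsto_log_div_rpow.const_mul |K|
    rw [mul_zero] at hK
    refine squeeze_zero_norm' ?_ hK
    filter_upwards [eventually_ge_atTop 1] with N hN
    have hN1 : (1 : ℝ) ≤ N := by exact_mod_cast hN
    have hN0 : (0 : ℝ) < N := by positivity
    have hlog : 0 ≤ Real.log N := Real.log_nonneg hN1
    have hP0 : 0 < (N : ℝ) ^ (61 / 62 : ℝ) := Real.rpow_pos_of_pos hN0 _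
    rw [Real.norm_eq_abs, abs_div, abs_mul, abs_of_nonneg hlog, abs_of_pos hN0]
    have haK : |a N| ≤ |K| * (N : ℝ) ^ (61 / 62 : ℝ) :=
      (ha N hN).trans (mul_le_mul_of_nonneg_right (le_abs_self K) hP0.le)
    calc |a N| * Real.log N / N ≤ |K| * (N : ℝ) ^ (61 / 62 : ℝ) * Real.log N / N := by gcongr
      _ = |K| * Real.log N * ((N : ℝ) ^ (61 / 62 : ℝ) / N) := by ring
      _ = |K| * (Real.log N / (N : ℝ) ^ (1 / 62 : ℝ)) := by
          rw [← Real.rpow_sub_one hN0.ne', show (61 / 62 : ℝ) - 1 = -(1 / 62) by norm_num,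
            Real.rpow_neg hN0.le]
          ring
  have hq := hnum.div tendsto_kummerPrimeCount_succ_mul_log_div (by norm_num : (1 / 2 : ℝ) ≠ 0)
  rw [zero_div] at hq
  refine hq.congr' ?_
  filter_upwards [eventually_ge_atTop 2] with N hN
  have hN0 : (N : ℝ) ≠ 0 := by positivity
  have hlog : Real.log N ≠ 0 := (Real.log_pos (by exact_mod_cast hN : (1 : ℝ) < N)).ne'
  show a N * Real.log N / N / ((kummerPrimeCount (N + 1) : ℝ) * Real.log N / N) =
    a N / (kummerPrimeCount (N + 1) : ℝ)
  rw [div_div_div_cancel_right₀ hN0, mul_div_mul_right _ _ hlog]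

end Asymptotics

/-! ### The bridge -/

section Bridge

variable (vP : ℕ → HeightOneSpectrum (𝓞 K3))
  (hvP : ∀ p : ℕ, p.Prime → p % 3 = 1 → vP p ≠ conjPrime (vP p) ∧
    primesOver p = {vP p, conjPrime (vP p)} ∧ (vP p).residueCard = p ∧ IsCoprime (vP p).asIdeal three)
  (hP : ∀ (ϖ : 𝓞 K3) (p : ℕ), Prime ϖ → ϖ - 1 ∈ three → p.Prime →
    Ideal.absNorm (Ideal.span ({ϖ} : Set (𝓞 K3))) = p →
    gauss ϖ = ∑ j ∈ Finset.Ico 1 p, cubicSymbol ϖ (j : 𝓞 K3) * Complex.exp (2 * Real.pi * Complex.I * j / p))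
  (hT1 : ∀ ε : ℝ, 0 < ε → ∃ C : ℝ, ∀ (l : ℤ) (X : ℕ),
    ‖∑ π ∈ primaryPrimesUpTo X,
        gaussTilde π * (conj (embC ((π : 𝓞 K3) : K3)) / (‖embC ((π : 𝓞 K3) : K3)‖ : ℂ)) ^ l‖ ≤
      C * (X : ℝ) ^ ε * ((X : ℝ) ^ (30 / 31 : ℝ) + |(l : ℝ)| * (X : ℝ) ^ (29 / 31 : ℝ)))

include hvP hP hT1 in
/-- **Theorem 1 (ε = 1/62) ⇒ `|Σ_{p ≤ N, p ≡ 1 (3)} cos(k θ_p)| ≤ K_k N^{61/62}`** for `3 ∤ k`, `N ≥ 1`.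
[cite: HeathBrownPatterson1979, §2 p.115] -/
theorem abs_sum_cos_le_rpow (r : ℕ → ℕ) (hr : ∀ p : ℕ, p.Prime → p % 3 = 1 → IsPrimitiveRoot (r p : ZMod p) (p - 1))
    {k : ℕ} (hk : ¬ 3 ∣ k) :
    ∃ K : ℝ, ∀ N : ℕ, 1 ≤ N →
      |∑ p ∈ (range (N + 1)).filter (fun p ↦ p.Prime ∧ p % 3 = 1), Real.cos (k * Complex.arg (cubicGaussSum p (r p)))| ≤
        K * (N : ℝ) ^ (61 / 62 : ℝ) := by
  obtain ⟨l, hl, hb⟩ := abs_sum_cos_le vP hvP hP r hr hk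
  obtain ⟨C, hC⟩ := hT1 (1 / 62) (by norm_num)
  set M := max C 0 with hM
  have hM0 : 0 ≤ M := le_max_right C 0
  have hlR : |(l : ℝ)| ≤ k := by rw [← Int.cast_abs]; exact_mod_cast hl
  refine ⟨(M * (1 + k) + 3) / 2, fun N hN ↦ (hb N).trans ?_⟩
  have hN1 : (1 : ℝ) ≤ N := by exact_mod_cast hN
  have hN0 : (0 : ℝ) < N := by positivity
  set P := (N : ℝ) ^ (61 / 62 : ℝ) with hPdef
  have hP1 : 1 ≤ P := Real.one_le_rpow hN1 (by norm_num)
  have f1 : (N : ℝ) ^ (1 / 62 : ℝ) * (N : ℝ) ^ (30 / 31 : ℝ) = P := by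
    rw [hPdef, ← Real.rpow_add hN0]; norm_num
  have f2 : (N : ℝ) ^ (1 / 62 : ℝ) * (N : ℝ) ^ (29 / 31 : ℝ) ≤ P := by
    rw [hPdef, ← Real.rpow_add hN0]; exact Real.rpow_le_rpow_of_exponent_le hN1 (by norm_num)
  have f3 : (Nat.sqrt N : ℝ) ≤ P := by
    refine Real.nat_sqrt_le_real_sqrt.trans ?_
    rw [Real.sqrt_eq_rpow, hPdef]; exact Real.rpow_le_rpow_of_exponent_le hN1 (by norm_num)
  have hT : ‖∑ π ∈ primaryPrimesUpTo N, T1term l π‖ ≤ M * (P + k * P) := by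
    have h := hC l N
    calc ‖∑ π ∈ primaryPrimesUpTo N, T1term l π‖
        ≤ C * (N : ℝ) ^ (1 / 62 : ℝ) * ((N : ℝ) ^ (30 / 31 : ℝ) + |(l : ℝ)| * (N : ℝ) ^ (29 / 31 : ℝ)) := h
      _ ≤ M * (N : ℝ) ^ (1 / 62 : ℝ) * ((N : ℝ) ^ (30 / 31 : ℝ) + |(l : ℝ)| * (N : ℝ) ^ (29 / 31 : ℝ)) := by
          rw [mul_assoc, mul_assoc]
          exact mul_le_mul_of_nonneg_right (le_max_left C 0) (by positivity)
      _ = M * ((N : ℝ) ^ (1 / 62 : ℝ) * (N : ℝ) ^ (30 / 31 : ℝ) +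
            |(l : ℝ)| * ((N : ℝ) ^ (1 / 62 : ℝ) * (N : ℝ) ^ (29 / 31 : ℝ))) := by ring
      _ ≤ M * (P + k * P) := by rw [f1]; gcongr
  calc (‖∑ π ∈ primaryPrimesUpTo N, T1term l π‖ + (Nat.sqrt N + 2)) / 2 ≤ (M * (P + k * P) + (P + 2 * P)) / 2 := by
        gcongr (?_ + (?_ + ?_)) / 2
        · linarith
    _ = (M * (1 + k) + 3) / 2 * P := by ring

include hvP hP hT1 in
/-- **Heath-Brown–Patterson's Weyl sums for `3 ∤ k`**, in the shape consumed by
`HeathBrownPatterson1979_kummerClasses_of_heathBrownPatterson`: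
`Σ_{p < B, p ≡ 1 (3)} cos(k θ_p) = o(#{p < B : p ≡ 1 (3)})`.
[cite: HeathBrownPatterson1979, Theorem 1 p.112 and §2 p.115] -/
theorem isLittleO_sum_cos_arg (r : ℕ → ℕ) (hr : ∀ p : ℕ, p.Prime → p % 3 = 1 → IsPrimitiveRoot (r p : ZMod p) (p - 1))
    {k : ℕ} (hk : ¬ 3 ∣ k) :
    (fun B ↦ ∑ p ∈ (Finset.range B).filter (fun p ↦ p.Prime ∧ p % 3 = 1),
        Real.cos (k * Complex.arg (cubicGaussSum p (r p)))) =o[atTop]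
      fun B ↦ (kummerPrimeCount B : ℝ) := by
  obtain ⟨K, hK⟩ := abs_sum_cos_le_rpow vP hvP hP hT1 r hr hk
  have h := tendsto_div_kummerPrimeCount_of_le hK
  have h' : Tendsto (fun B : ℕ ↦ (∑ p ∈ (Finset.range B).filter (fun p ↦ p.Prime ∧ p % 3 = 1),
      Real.cos (k * Complex.arg (cubicGaussSum p (r p)))) / (kummerPrimeCount B : ℝ)) atTop (nhds 0) :=
    (tendsto_add_atTop_iff_nat 1).1 h
  refine isLittleO_of_tendsto (fun B hB ↦ ?_) h'
  have h0 : (Finset.range B).filter (fun p ↦ p.Prime ∧ p % 3 = 1) = ∅ := by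
    rw [← Finset.card_eq_zero]; exact_mod_cast hB
  rw [h0, Finset.sum_empty]

end Bridge

end HeathBrownPatterson

open HeathBrownPatterson in
/-- **Heath-Brown–Patterson 1979: Theorem 1 (+ Patterson's identity) ⇒ Kummer's three classes have
density `1/3` each.** The hypotheses are, verbatim in the vocabulary of `EisensteinCubicGaussSums`:

* `hT1` — Theorem 1 of the paper in its prime form (p. 115, from p. 112 by partial summation):
  for every `ε > 0` there is `C` with
  `‖Σ_{N(π) ≤ X, π ≡ 1 (3) prime} g̃(π) (π̄/|π|)^l‖ ≤ C X^ε (X^{30/31} + |l| X^{29/31})` for all `l ∈ ℤ`,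
  `X ∈ ℕ`;
* `hP` — Patterson's identity (p. 111): for `ϖ` a primary prime of prime norm `p`,
  `g(ϖ) = Σ_{j=1}^{p−1} (j/ϖ)₃ e^{2πij/p}`.

Conclusion: the named fact `HeathBrownPatterson1979_kummerClasses` (the paper's Theorem 2 in the
three-interval form of Ireland–Rosen p. 138). The deduction is the paper's §2, p. 115, composed with
the sorry-free reductions of `KummerClassesEquidistributionProofs` / `…HeckeProofs`.
[cite: HeathBrownPatterson1979, Theorem 1 p.112, Theorem 2 p.113, §2 p.115] -/
theorem HeathBrownPatterson1979_kummerClasses_of_thm1_of_patterson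
    (hT1 : ∀ ε : ℝ, 0 < ε → ∃ C : ℝ, ∀ (l : ℤ) (X : ℕ),
      ‖∑ π ∈ primaryPrimesUpTo X,
          gaussTilde π * (conj (embC ((π : 𝓞 K3) : K3)) / (‖embC ((π : 𝓞 K3) : K3)‖ : ℂ)) ^ l‖ ≤
        C * (X : ℝ) ^ ε * ((X : ℝ) ^ (30 / 31 : ℝ) + |(l : ℝ)| * (X : ℝ) ^ (29 / 31 : ℝ)))
    (hP : ∀ (ϖ : 𝓞 K3) (p : ℕ), Prime ϖ → ϖ - 1 ∈ three → p.Prime →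
      Ideal.absNorm (Ideal.span ({ϖ} : Set (𝓞 K3))) = p →
      gauss ϖ = ∑ j ∈ Finset.Ico 1 p, cubicSymbol ϖ (j : 𝓞 K3) * Complex.exp (2 * Real.pi * Complex.I * j / p)) :
    HeathBrownPatterson1979_kummerClasses := by
  have hr0 : ∀ p : ℕ, ∃ r : ℕ, p.Prime → p % 3 = 1 → IsPrimitiveRoot (r : ZMod p) (p - 1) := by
    intro p
    by_cases hp : p.Prime
    · haveI : Fact p.Prime := ⟨hp⟩
      obtain ⟨r, hr⟩ := KummerClasses.exists_isPrimitiveRoot_zmod p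
      exact ⟨r, fun _ _ ↦ hr⟩
    · exact ⟨0, fun h _ ↦ absurd h hp⟩
  choose r hr using hr0
  choose vP hvP using exists_split_prime
  exact HeathBrownPatterson1979_kummerClasses_of_heathBrownPatterson r hr
    fun k hk ↦ isLittleO_sum_cos_arg vP hvP hP hT1 r hr hk

end Literature.NumberTheory.GaussSums
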